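import Summits.BirchSwinnertonDyer.BirchSwinnertonDyer.Theorems.KatoDescentTamePotSupersingularJetchevIrreducibleSwapStep
import Summits.BirchSwinnertonDyer.BirchSwinnertonDyer.Theorems.Rank1ResidualJetSwapWalk
import Summits.BirchSwinnertonDyer.BirchSwinnertonDyer.Theorems.Rank1ResidualJetCompatibleData
import Summits.BirchSwinnertonDyer.BirchSwinnertonDyer.Theorems.Rank1ResidualJetCompatibleDataDown
import HarnessLib

/-!
# Crux `JetchevIrreducibleReadingByName` (item 20165, shared K8-t′ / K9, cell `bsd-potss`), registered stub S2′
# `stub_prop52IrredP` (McCallum 1991 Prop. 5.2 in the IRREDUCIBLE reading): LEVEL RAISING AT MINIMAL DEPTH by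
# Kolyvagin's prime-swap WALK, assembled on an irreducible row — the `hraise` input of cell `bsd-jet`'s bridge
# `JET.derivedPoint_divisible_of_levelRaising_of_section6_min`, modulo the level-`p` structures and the row binder `h47row`

Seat `bsd-potss-k8t-c4` g12 (prover), `--supports stmt-BirchSwinnertonDyer-20165`, helper; route-free. HONEST
FRAMING: helper theorems only; nothing is booked, no item closes, BSD is proved for no curve by any of this.

WHAT. McCallum's Prop. 5.2 (LMS LN 153, p. 304; case `C = {0}`) is consumed by the §6 bridge ONLY as «level raising
at minimal depth»: from a conductor `n₀` of Kolyvagin primes of index `≥ 1 + u` carrying a datum whose derived point is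
NOT `p^{u+1}`-divisible, `u` being MINIMAL among such depths (`hmin`), reach conductors of arbitrarily large index
keeping a non-`p^{u+1}`-divisible datum (pv-2 g6's binder `hraise` of `JET.derivedPoint_divisible_of_levelRaising_of_section6_min`,
`Rank1ResidualJetSection6BridgeSwap`, p549281 — image-free). The printed proof (pp. 305–306) is Kolyvagin's swap walk:
replace a prime `ℓ₀ ∣ n` of small index by a fresh prime `ℓ'` of large index. This file ASSEMBLES that walk on an
IRREDUCIBLE row (`E[p]` irreducible, `p ∣ N_E`):
* `exists_conductor_levelIndex_ge_of_minDepth_of_irreducible` — the walk `JET.Swap.exists_forall_le_index_of_swapStep`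
  (pv-2, pure combinatorics) with the invariant «square-free, Kolyvagin primes of index `≥ 1 + u` all satisfying the
  guard `G`, some datum not `p^{u+1}`-divisible», its step supplied by this seat's two halves
  `exists_swapPrime_of_irreducible` (`λ'`: root class, auxiliary class, decoupled Čebotarev on the irreducible row) and
  `not_dvd_of_swap_of_irreducible` (`λ₀`: Prop. 4.4 twice around the exclusion lemma), the COMPATIBLE DATA TRIPLE being
  DISCHARGED by the tree's UP construction `JET.exists_compatible_data_of_grossCM` (pv-2, `d ≼ d'` at `n ∣ nℓ'`) and
  DOWN construction `JET.exists_compatible_datum_of_dvd_of_grossCM` (pv-1 g8, `d'' ≼ d'` at `nℓ'/ℓ₀ ∣ nℓ'`) — so the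
  plumbing binder `hcompat` of the cell `bsd-jet` STATUS does not appear; data at the other divisors of `n` by
  `nonempty_kolyvaginHeegnerData_of_grossCM` (Gross §3 CM facts by their `_holds` theorems).
  The guard `G` of the row binder (for the `h47P2` keying `G := (· ≠ 2)`, for `h47P` `G := ⊤`) is asked of EVERY
  Zhang–Kolyvagin prime (`hG`; for `(· ≠ 2)` this is `p ≠ 3`, automatic on the K8-t′ face).
RESIDUAL (hypotheses, all image-free): the row binder `h47row` (McCallum Prop. 4.4, localisation-order form, guard `G`),
the level-`p` Poitou–Tate package `inv` + Weil datum `e`, the transverse family `𝒯` with `h𝒯`/`h𝒯σ`/`h𝒯sd`/`hloc`/`hdisj`,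
[GZ86 III (3.1)] in the Kolyvagin-scoped receptacle shape `hGZ` with `n'` prime to `p`; frame `¬CM` (literal, for
Čebotarev), `d_K ∉ {−3,−4}`, Heegner, `p` odd, `τ ≠ 1`, `τ² = 1`. The sequel feeds them from {hPT, F1′/hGZ′, h47P2 or h47P}.

References (locators only; no cited FACT is declared): [cite: McCallumLMS1991, §5 Prop. 5.2 and proof (pp. 304–306),
§4 Prop. 4.4, §3 Cor. 3.2] [cite: Jetchev2008, proof of Thm. 1.4 (p. 824), §3.1 item 7, Lemma 5.1–5.2, Rem. 6.2]
[cite: GrossLMS1991, §3 (pp. 238–239), §4 (4.1), Prop. 6.2 (1)] [cite: GrossZagier1986, III (3.1)].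
Design: theorems only; `K : Type`. Axioms: `propext`, `Classical.choice`, `Quot.sound`.
-/

set_option autoImplicit false
-- the Theorems directory repeats the summit name (sibling precedent `KatoDescentPotSupersingularAssembly.lean`)
set_option linter.dupNamespace false

noncomputable section
open scoped Classical Pointwise
open Function NumberField IsDedekindDomain WeierstrassCurve Field
open Literature.NumberTheory.EllipticCurves Literature.NumberTheory.GaloisRepresentations
open Literature.NumberTheory.EllipticCurves.Jetchev2008 Literature.NumberTheory.EllipticCurves.KolyvaginCocycle
open Literature.NumberTheory.EllipticCurves.ModularForms
open Literature.NumberTheory.GaloisCohomology Literature.NumberTheory.Automorphic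
open Literature.NumberTheory.GaloisRepresentations.DiscreteGaloisModule (transverseSubgroup SelmerStructure)
open Summit.BirchSwinnertonDyer.Rank1Residual
open Summit.BirchSwinnertonDyer.Rank1Residual.JET
open Summit.BirchSwinnertonDyer.Rank1Residual.JET.SelmerVocabulary
open Summit.BirchSwinnertonDyer.Rank1Residual.JET.GlobalDuality
open Summit.BirchSwinnertonDyer.Rank1Residual.JET.Swap
open Summit.BirchSwinnertonDyer.Rank1Residual.X11b
open Summit.BirchSwinnertonDyer.Rank1Residual.X11b.Three
open Summit.BirchSwinnertonDyer.BirchSwinnertonDyer.Theorems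

namespace Summit.BirchSwinnertonDyer.BirchSwinnertonDyer.Theorems.JetchevIrreducibleSwap

variable {K : Type} [Field K] [NumberField K] (W : WeierstrassCurve ℚ) [W.IsElliptic]
  [W.IsGloballyMinimal] [NeZero (W.conductorNorm ℤ)]

section Prime

variable (τ : K ≃ₐ[ℚ] K) (p : ℕ) [Fact p.Prime] [NeZero (p ^ 1)]
  [Finite (geomTorsion (W.baseChange K) ((p ^ 1 : ℕ) : ℤ))]
  (e : geomTorsion (W.baseChange K) ((p ^ 1 : ℕ) : ℤ) → geomTorsion (W.baseChange K) ((p ^ 1 : ℕ) : ℤ) →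
    AlgebraicClosure K)
  (hμ : ∀ S T, e S T ^ (p ^ 1) = 1)
  (hadd₁ : ∀ S₁ S₂ T, e (S₁ + S₂) T = e S₁ T * e S₂ T)
  (hadd₂ : ∀ S T₁ T₂, e S (T₁ + T₂) = e S T₁ * e S T₂)
  (hgal : ∀ (g : absoluteGaloisGroup K) (S T : geomTorsion (W.baseChange K) ((p ^ 1 : ℕ) : ℤ)),
    g • e S T = e (g • S) (g • T))
  (halt : ∀ T, e T T = 1) (hnondeg : ∀ T, (∀ S, e S T = 1) → T = 0)
  (hτe : ∀ S T, liftAut τ (e S T) =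
    e ((isLiftOfAut_liftAut τ).torsionMap W ((p ^ 1 : ℕ) : ℤ) S)
      ((isLiftOfAut_liftAut τ).torsionMap W ((p ^ 1 : ℕ) : ℤ) T))

set_option maxHeartbeats 400000 in
include halt hnondeg hτe in
/-- **Level raising at minimal depth by Kolyvagin's prime-swap walk, on an IRREDUCIBLE row** (McCallum 1991, proof of
Prop. 5.2, pp. 305–306: «Replacing `n` by `nl'/l_0` … and hence eventually … `S ⊂ S(M)`»). Given the frame, the level-`p`
structures, the row binder `h47row` (guard `G` holding at every Kolyvagin prime), [GZ86 III (3.1)] scoped, the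
MINIMALITY of the depth `u` over conductors of index `≥ 1 + u` (`hmin`), and a start conductor `n₀` (square-free,
Kolyvagin primes of index `≥ 1 + u`) with a datum NOT `p^{u+1}`-divisible: for every `m'` there is a square-free
conductor `n` of Kolyvagin primes of index `≥ max m' (1 + u)` with a datum NOT `p^{u+1}`-divisible — VERBATIM the
conclusion of pv-2's binder `hraise`. PROOF: the
walk `JET.Swap.exists_forall_le_index_of_swapStep`, one step = `exists_swapPrime_of_irreducible` + UP/DOWN compatible
data + `not_dvd_of_swap_of_irreducible`. [cite: McCallumLMS1991, §5 proof of Prop. 5.2 (pp. 305–306)]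
[cite: Jetchev2008, proof of Thm. 1.4 (p. 824)] -/
theorem exists_conductor_levelIndex_ge_of_minDepth_of_irreducible (hK : IsImaginaryQuadratic K)
    (hD3 : NumberField.discr K ≠ -3) (hD4 : NumberField.discr K ≠ -4)
    (hH : SatisfiesHeegnerHypothesis (W.conductorNorm ℤ) K) (hcm : ¬ W.HasCM) (hp2 : p ≠ 2)
    (hirr : W.HasIrreducibleModPGaloisRep p) (hpN : p ∣ W.conductorNorm ℤ) (hτ1 : τ ≠ 1) (hττ : τ * τ = 1)
    (Dt : ModularParametrizationData W (W.conductorNorm ℤ)) (β : ℤ) (ι : K →+* ℂ)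
    [∀ j : ℕ, NumberField (ringClassField K ι j)]
    (G : ℕ → Prop) (hG : ∀ ℓ : ℕ, Zhang2014.IsKolyvaginPrime (W.conductorNorm ℤ) W K p ℓ → G ℓ)
    (h47row : ∀ (M : ℕ), 1 ≤ M → ∀ (m l : ℕ), Squarefree (m * l) → l.Prime → G l → ¬ l ∣ m →
      (∀ l' ∈ (m * l).primeFactors, Zhang2014.IsKolyvaginPrime (W.conductorNorm ℤ) W K p l' ∧
        M ≤ Zhang2014.kolyvaginIndex W p l') →
      ∀ (d : KolyvaginHeegnerData Dt β ι m) (d' : KolyvaginHeegnerData Dt β ι (m * l)),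
      (∀ l' ∈ m.primeFactors, ∀ (x : ringClassField K ι m) (x' : ringClassField K ι (m * l)),
        (x : ℂ) = x' → ((d'.σ l' x' : ringClassField K ι (m * l)) : ℂ) = (d.σ l' x : ℂ)) →
      (∀ s ∈ d.S, ∃ s' ∈ d'.S, ∀ (x : ringClassField K ι m) (x' : ringClassField K ι (m * l)),
        (x : ℂ) = x' → ((s' x' : ringClassField K ι (m * l)) : ℂ) = (s x : ℂ)) →
      (∀ s' ∈ d'.S, ∃ s ∈ d.S, ∀ (x : ringClassField K ι m) (x' : ringClassField K ι (m * l)),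
        (x : ℂ) = x' → ((s' x' : ringClassField K ι (m * l)) : ℂ) = (s x : ℂ)) →
      (∀ (x : ringClassField K ι m) (x' : ringClassField K ι (m * l)),
        (x : ℂ) = x' → d'.emb x' = d.emb x) →
      ∀ (v : HeightOneSpectrum (𝓞 K)), (l : 𝓞 K) ∈ v.asIdeal →
      addOrderOf ((galoisCohomology.localization
          ((W.baseChange K).torsionGaloisModule ((p ^ M : ℕ) : ℤ)) (Sum.inr v) 1 :
            galH1Torsion (W.baseChange K) ((p ^ M : ℕ) : ℤ) →+ _)
          (d'.kolyvaginClass (Fact.out : p.Prime) M)) =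
        addOrderOf ((galoisCohomology.localization
          ((W.baseChange K).torsionGaloisModule ((p ^ M : ℕ) : ℤ)) (Sum.inr v) 1 :
            galH1Torsion (W.baseChange K) ((p ^ M : ℕ) : ℤ) →+ _)
          (d.kolyvaginClass (Fact.out : p.Prime) M)))
    (inv : LocalInvariants K (p ^ 1)) (hperf : inv.IsPerfect) (hvan : inv.SumLocalTermEqZero)
    (hSC : inv.SelmerComplement) (hinv : inv.IsConjCompatible τ)
    (𝒯 : SelmerStructure ((W.baseChange K).torsionGaloisModule ((p ^ 1 : ℕ) : ℤ)))
    (h𝒯 : ∀ v : HeightOneSpectrum (𝓞 K), 𝒯 (Sum.inr v) =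
      ⨅ (ℓ : ℕ) (_ : ℓ.Prime ∧ (ℓ : 𝓞 K) ∈ v.asIdeal),
        ⨅ (w' : HeightOneSpectrum (𝓞 (ringClassField K ι ℓ)))
          (_ : w'.asIdeal.LiesOver v.asIdeal),
          letI := (adicCompletionOfLiesOver K (ringClassField K ι ℓ) v w').toAlgebra
          transverseSubgroup (GaloisRep.toLocal v ((W.baseChange K).torsionGaloisModule ((p ^ 1 : ℕ) : ℤ)))
            (w'.adicCompletion (ringClassField K ι ℓ)))
    (h𝒯σ : ∀ (c : ℕ), Squarefree c →
      (∀ q ∈ c.primeFactors, Zhang2014.IsKolyvaginPrime (W.conductorNorm ℤ) W K p q) →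
      ∀ (v w : HeightOneSpectrum (𝓞 K)) (h : τ • v = w), v ∈ placesDividing K c →
      ∀ x : galoisCohomology (((W.baseChange K).torsionGaloisModule ((p ^ 1 : ℕ) : ℤ)).toLocal
        (Sum.inr v : Place K)) 1,
      x ∈ 𝒯 (Sum.inr v) → conjActPlace W τ ((p ^ 1 : ℕ) : ℤ) h x ∈ 𝒯 (Sum.inr w))
    (h𝒯sd : ∀ (c : ℕ), Squarefree c →
      (∀ q ∈ c.primeFactors, Zhang2014.IsKolyvaginPrime (W.conductorNorm ℤ) W K p q) →
      ∀ v ∈ placesDividing K c,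
      inv.dualTransported 𝒯 (weilDualIntertwining (W.baseChange K) (p ^ 1) e hμ hadd₁ hadd₂ hgal)
        (Sum.inr v) = 𝒯 (Sum.inr v))
    (hloc : ∀ ℓ : ℕ, Zhang2014.IsKolyvaginPrime (W.conductorNorm ℤ) W K p ℓ →
      1 ≤ Zhang2014.kolyvaginIndex W p ℓ →
      ∀ (v : HeightOneSpectrum (𝓞 K)), (ℓ : 𝓞 K) ∈ v.asIdeal → ∀ (hfix : τ • v = v) (s : ℤ),
      (s = 1 ∨ s = -1) →
      ((W.baseChange K).kummerSelmerStructure ((p ^ 1 : ℕ) : ℤ) (Sum.inr v)).relIndex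
        ((conjActPlace W τ ((p ^ 1 : ℕ) : ℤ) hfix - s • AddMonoidHom.id _).ker) = p ^ 1)
    (hdisj : ∀ ℓ : ℕ, Zhang2014.IsKolyvaginPrime (W.conductorNorm ℤ) W K p ℓ →
      ∀ v : HeightOneSpectrum (𝓞 K), (ℓ : 𝓞 K) ∈ v.asIdeal →
      Disjoint ((W.baseChange K).kummerSelmerStructure ((p ^ 1 : ℕ) : ℤ) (Sum.inr v)) (𝒯 (Sum.inr v)))
    {n' : ℤ} (hcop' : IsCoprime (p : ℤ) n')
    (hGZ : ∀ (m : ℕ), Squarefree m →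
      (∀ q ∈ m.primeFactors, Zhang2014.IsKolyvaginPrime (W.conductorNorm ℤ) W K p q) →
      ∀ (dm : KolyvaginHeegnerData Dt β ι m)
      (γ : ringClassField K ι m ≃ₐ[ℚ] ringClassField K ι m), γ ∈ ringClassGal ι m →
      ∀ v : HeightOneSpectrum (𝓞 K), ¬ (W.baseChange K).HasGoodReductionAt v →
        n' • pointsMap (W.baseChange K) (v.adicCompletion K)
            (dm.toGeomPoints (pointGalHom W (ringClassField K ι m) γ dm.y)) ∈
          E0Receptacle (W.baseChange K) v ∧
        ∀ (ℓ : ℕ), ℓ ∈ m.primeFactors → ∀ (dm' : KolyvaginHeegnerData Dt β ι (m / ℓ))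
          (hle : ringClassField K ι (m / ℓ) ≤ ringClassField K ι m),
          n' • pointsMap (W.baseChange K) (v.adicCompletion K)
              (dm.toGeomPoints (pointGalHom W (ringClassField K ι m) γ
                (WeierstrassCurve.Affine.Point.map (W' := W)
                  ((RingClassField.inclusion ι hle).restrictScalars ℚ) dm'.y))) ∈
            E0Receptacle (W.baseChange K) v)
    {u : ℕ}
    (hmin : ∀ (c : ℕ), Squarefree c →
      (∀ q ∈ c.primeFactors, Zhang2014.IsKolyvaginPrime (W.conductorNorm ℤ) W K p q ∧
        1 + u ≤ Zhang2014.kolyvaginIndex W p q) →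
      ∀ dc : KolyvaginHeegnerData Dt β ι c,
      ∃ Q : (W.baseChange (ringClassField K ι c)).toAffine.Point, ((p ^ u : ℕ) : ℤ) • Q = dc.derivedPoint)
    {n₀ : ℕ} (hn₀ : Squarefree n₀)
    (hn₀K : ∀ q ∈ n₀.primeFactors, Zhang2014.IsKolyvaginPrime (W.conductorNorm ℤ) W K p q ∧
      1 + u ≤ Zhang2014.kolyvaginIndex W p q)
    (d₀ : KolyvaginHeegnerData Dt β ι n₀)
    (hnd₀ : ¬ ∃ Q : (W.baseChange (ringClassField K ι n₀)).toAffine.Point,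
      ((p ^ (u + 1) : ℕ) : ℤ) • Q = d₀.derivedPoint)
    (m' : ℕ) :
    ∃ (n : ℕ) (d : KolyvaginHeegnerData Dt β ι n), Squarefree n ∧
      (∀ q ∈ n.primeFactors, Zhang2014.IsKolyvaginPrime (W.conductorNorm ℤ) W K p q ∧
        max m' (1 + u) ≤ Zhang2014.kolyvaginIndex W p q) ∧
      ¬ ∃ Q : (W.baseChange (ringClassField K ι n)).toAffine.Point,
        ((p ^ (u + 1) : ℕ) : ℤ) • Q = d.derivedPoint := by
  have hp : p.Prime := Fact.out
  have hD : NumberField.discr K < -4 := KolyvaginAssembly.discr_lt_neg_four hK ⟨hD3, hD4⟩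
  have hCM1 : phi_heegnerPointOfConductor_mem_range_map_ringClassField (W.conductorNorm ℤ) W K :=
    phi_heegnerPointOfConductor_mem_range_map_ringClassField_holds (W.conductorNorm ℤ) W K
  have hCM2 : exists_generator_ringClassGalOver K := exists_generator_ringClassGalOver_holds
  -- the walk's invariant
  let Good : ℕ → Prop := fun n ↦ Squarefree n ∧
    (∀ q ∈ n.primeFactors, Zhang2014.IsKolyvaginPrime (W.conductorNorm ℤ) W K p q ∧
      1 + u ≤ Zhang2014.kolyvaginIndex W p q) ∧
    ∃ d : KolyvaginHeegnerData Dt β ι n, ¬ ∃ Q : (W.baseChange (ringClassField K ι n)).toAffine.Point,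
      ((p ^ (u + 1) : ℕ) : ℤ) • Q = d.derivedPoint
  have h₀ : Good n₀ := ⟨hn₀, hn₀K, d₀, hnd₀⟩
  suffices hstep : ∀ n, Good n → ∀ ℓ₀ ∈ n.primeFactors, Zhang2014.kolyvaginIndex W p ℓ₀ < max m' (1 + u) →
      ∃ ℓ' : ℕ, ℓ'.Prime ∧ ℓ' ∉ n.primeFactors ∧ max m' (1 + u) ≤ Zhang2014.kolyvaginIndex W p ℓ' ∧
        Good (n / ℓ₀ * ℓ') by
    obtain ⟨n, ⟨hn, hnK, d, hnd⟩, hidx⟩ := Swap.exists_forall_le_index_of_swapStep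
      (Zhang2014.kolyvaginIndex W p) (max m' (1 + u)) Good (fun n h ↦ h.1) hstep h₀
    exact ⟨n, d, hn, fun q hq ↦ ⟨(hnK q hq).1, hidx q hq⟩, hnd⟩
  -- ### ONE SWAP `n ↦ n/ℓ₀ · ℓ'`
  rintro n ⟨hn, hnK, d, hnd⟩ l₀ hl₀ -
  have hn0 : n ≠ 0 := hn.ne_zero
  have hl₀n : l₀ ∣ n := Nat.dvd_of_mem_primeFactors hl₀
  have hinert : ∀ (m : ℕ), m ∣ n → ∀ q ∈ m.primeFactors, (Ideal.span {(q : 𝓞 K)}).IsPrime :=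
    fun m hm q hq ↦ (hnK q (Nat.primeFactors_mono hm hn0 hq)).1.2.2.2.2.1
  -- data at every divisor of `n` (the given `d` at `n` itself)
  have hne : ∀ m : ℕ, m ∣ n → Nonempty (KolyvaginHeegnerData Dt β ι m) := fun m hm ↦
    nonempty_kolyvaginHeegnerData_of_grossCM hCM1 hCM2 hK hH Dt β ι d.dvd_sq_sub (hn.squarefree_of_dvd hm)
      (hinert m hm)
  let data : (m : ℕ) → m ∣ n → KolyvaginHeegnerData Dt β ι m := fun m hm ↦
    if h : m = n then h ▸ d else (hne m hm).some
  have hdata : data n dvd_rfl = d := by simp [data]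
  have hdvd : ∃ Q : (W.baseChange (ringClassField K ι n)).toAffine.Point,
      ((p ^ u : ℕ) : ℤ) • Q = (data n dvd_rfl).derivedPoint := by
    rw [hdata]; exact hmin n hn hnK d
  have hndvd : ¬ ∃ Q : (W.baseChange (ringClassField K ι n)).toAffine.Point,
      ((p ^ (u + 1) : ℕ) : ℤ) • Q = (data n dvd_rfl).derivedPoint := by
    rw [hdata]; exact hnd
  -- the `λ'` half: a fresh Kolyvagin prime `ℓ' > n` of index `≥ 1 + (m' + u)`
  obtain ⟨ℓ', v', v₀, t, -, hKol', hjℓ', hℓ'n, hv', hv₀, ht, htv', hxup⟩ :=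
    exists_swapPrime_of_irreducible W τ p e hμ hadd₁ hadd₂ hgal halt hnondeg hτe hK hD3 hD4 hH hcm hp2 hirr hpN
      hτ1 hττ Dt β ι inv hperf hvan hSC hinv 𝒯 h𝒯σ h𝒯sd hloc (u := u) (j := m' + u) (Nat.le_add_left u m')
      n hn hnK hl₀ data hdvd hndvd
  rw [hdata] at hxup
  have hGℓ' : G ℓ' := hG ℓ' hKol'
  have h1u : 1 + u ≤ Zhang2014.kolyvaginIndex W p ℓ' := le_trans (by omega) hjℓ'
  have hℓ'p : ℓ'.Prime := hKol'.1
  -- UP: a datum at `n · ℓ'` compatible with `d`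
  obtain ⟨dℓ, hdℓ⟩ := exists_compatible_data_of_grossCM hCM1 hK hD hH p Dt β ι hn (fun q hq ↦ (hnK q hq).1) d
  obtain ⟨hσ, hS, hS', hemb⟩ := hdℓ ℓ' hKol' hℓ'n
  -- DOWN: a datum at `n/ℓ₀ · ℓ'` compatible with the datum at `n · ℓ'`
  have hℓ'dvd : ¬ ℓ' ∣ n := fun h ↦ hℓ'n (Nat.mem_primeFactors.mpr ⟨hℓ'p, h, hn0⟩)
  have hN : Squarefree (n * ℓ') :=
    (Nat.squarefree_mul ((Nat.Prime.coprime_iff_not_dvd hℓ'p).mpr hℓ'dvd).symm).mpr ⟨hn, hℓ'p.squarefree⟩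
  have hNK : ∀ q ∈ (n * ℓ').primeFactors, Zhang2014.IsKolyvaginPrime (W.conductorNorm ℤ) W K p q := by
    intro q hq
    rw [Nat.primeFactors_mul hn0 hℓ'p.ne_zero, hℓ'p.primeFactors, Finset.mem_union,
      Finset.mem_singleton] at hq
    rcases hq with hq | rfl
    · exact (hnK q hq).1
    · exact hKol'
  have hdvd'' : n / l₀ * ℓ' ∣ n * ℓ' := Nat.mul_dvd_mul_right (Nat.div_dvd_of_dvd hl₀n) ℓ'
  obtain ⟨d'', hσ₁, hS₁, hS₁', hemb₁⟩ := exists_compatible_datum_of_dvd_of_grossCM hK hD hH p Dt β ι hN hNK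
    hdvd'' (dℓ ℓ' hKol' hℓ'n)
  -- the `λ₀` half
  have key := not_dvd_of_swap_of_irreducible W τ p e hμ hadd₁ hadd₂ hgal halt hnondeg hτe hK hD3 hD4 hH hp2 hirr
    hpN hτ1 hττ Dt β ι G h47row inv hperf hvan hSC hinv 𝒯 h𝒯 h𝒯σ h𝒯sd hloc hdisj hcop' hGZ hmin hn hnK hl₀
    hKol' h1u hℓ'n hGℓ' (hG l₀ (hnK l₀ hl₀).1) hv' hv₀ d (dℓ ℓ' hKol' hℓ'n) hσ hS hS' hemb hxup t ht htv' d'' hσ₁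
    hS₁ hS₁' hemb₁
  refine ⟨ℓ', hℓ'p, hℓ'n, le_trans ?_ hjℓ', Swap.squarefree_swap hn hl₀ hℓ'p hℓ'n, ?_, d'', key⟩
  · omega
  · intro q hq
    rw [Swap.primeFactors_swap hn hl₀ hℓ'p, Finset.mem_insert, Finset.mem_erase] at hq
    rcases hq with rfl | ⟨-, hq⟩
    · exact ⟨hKol', h1u⟩
    · exact hnK q hq

end Prime

end Summit.BirchSwinnertonDyer.BirchSwinnertonDyer.Theorems.JetchevIrreducibleSwap

end
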